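import Literature.Combinatorics.Designs.WilliamsonArray

/-!
# Hadamard 668 census — the Williamson-family (+) control in the kernel: a Williamson matrix of order 52

Framing: lottery ticket; floor = certified bounds/negative ranges.

Cell pub-namedobj (venture DiscreteObjects), target (H).  The Williamson-type family (F3 of TABLE-H; its (−) control is
the exhaustively reproduced non-existence at `n = 35`) has as (+) side the classified small orders; the cell's engine W1
(j081683) lists, e.g., for `n = 13` the class representative
`a = +-----++-----`, `b = +-+--++++--+-`, `c = +-++--++--++-`, `d = +++-+----+-++` (row sums −7, 1, 1, 1;
`7² + 1 + 1 + 1 = 52`).  Here these four symmetric `±1` sequences on `ZMod 13` are checked in the kernel (symmetry and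
`Σ PAF = 0` at the 12 non-zero shifts by `decide`) and the formalised Williamson theorem
(`williamson_isHadamard`, Literature/…/WilliamsonArray) makes the Williamson array on them a kernel-certified Hadamard
matrix of order `52 = |Fin 4 × ZMod 13|`.  With `H428Certificate` (Goethals–Seidel family) and `PaleyLP167`
(two-circulant core) every array family of the census now has a kernel-certified (+) control object.
Ours (certificate of a classical object); no `sorry`, no `native_decide`.
-/

open Matrix

namespace Summit.Ventures.DiscreteObjects.Hadamard

open Literature.Combinatorics.Designs.LegendrePairs (PAF IsPM)
open Literature.Combinatorics.Designs.GoethalsSeidel (IsHadamardMatrix)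
open Literature.Combinatorics.Designs.Williamson (wMatrix williamson_isHadamard)

/-- `±1` sequence on `ZMod 13` from a bit mask (bit `i` set ↦ `-1`) -/
def seq13 (m : ℕ) (i : ZMod 13) : ℤ := if Nat.testBit m i.val then -1 else 1

/-- such a sequence is `±1`-valued -/
lemma isPM_seq13 (m : ℕ) : IsPM (seq13 m) := fun i => by
  unfold seq13; split <;> simp

/-- Williamson row `a = +-----++-----` of order 13 (bits 1–5, 8–12 set) -/
def w13a : ZMod 13 → ℤ := seq13 0b1111100111110
/-- Williamson row `b = +-+--++++--+-` -/
def w13b : ZMod 13 → ℤ := seq13 0b1011000011010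
/-- Williamson row `c = +-++--++--++-` -/
def w13c : ZMod 13 → ℤ := seq13 0b1001100110010
/-- Williamson row `d = +++-+----+-++` -/
def w13d : ZMod 13 → ℤ := seq13 0b0010111101000

/-- the four rows are symmetric (`x (-i) = x i`), by kernel evaluation -/
theorem w13_symm : (∀ i : ZMod 13, w13a (-i) = w13a i) ∧ (∀ i : ZMod 13, w13b (-i) = w13b i) ∧
    (∀ i : ZMod 13, w13c (-i) = w13c i) ∧ (∀ i : ZMod 13, w13d (-i) = w13d i) := by
  refine ⟨?_, ?_, ?_, ?_⟩ <;> decide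

set_option maxRecDepth 100000 in
/-- the Williamson condition `Σ PAF = 0` at every non-zero shift, by kernel evaluation -/
theorem w13_paf : ∀ s : ZMod 13, s ≠ 0 → PAF w13a s + PAF w13b s + PAF w13c s + PAF w13d s = 0 := by
  decide

/-- **A Williamson matrix of order 52, certified**: the Williamson array on the four rows is a Hadamard matrix of
order `52 = |Fin 4 × ZMod 13|`. -/
theorem williamson52_certificate :
    IsHadamardMatrix (wMatrix (circulant w13a) (circulant w13b) (circulant w13c) (circulant w13d)) ∧
      Fintype.card (Fin 4 × ZMod 13) = 52 :=
  ⟨williamson_isHadamard _ _ _ _ (isPM_seq13 _) (isPM_seq13 _) (isPM_seq13 _) (isPM_seq13 _)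
    w13_symm.1 w13_symm.2.1 w13_symm.2.2.1 w13_symm.2.2.2 w13_paf, by simp [ZMod.card]⟩

end Summit.Ventures.DiscreteObjects.Hadamard
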